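import Summits.HubbardSuperconductivity.HubbardSuperconductivity.Theses.DeformationLadder
import Literature.MathematicalPhysics.QuantumLattice.PairCorrelations

/-!
# Vocabulary of the Poincaré telescope for the crux `LowEnergyRigidity` (route `DeformationLadder`)

Crux item stmt-HubbardSuperconductivity-1892, decl
`Summit.HubbardSuperconductivity.HubbardSuperconductivity.Theses.DeformationLadder.LowEnergyRigidity`
(for some `U > 0`, `δ ∈ (0,1/2)`, `κ > 0`, `a > 0` and all large even `L`, EVERY unit vector `φ` of
the sector `K_L = szSector N_L 0`, `N_L = 2⌊(1-δ)L²/2⌋`, with `Re⟨φ, H_L φ⟩ ≤ minEnergyOn H_L K_L + κ`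
has `d`-wave LRO density `L⁻⁴ Re⟨φ, Δ_dᴴΔ_d φ⟩ ≥ a`; `H_L = hubbardTorus 2 L 1 U`,
`Δ_d = pairField dWaveFormFactor L`).

This file only NAMES the objects of the crux idea `poincare-telescope` (crux-ideate round 1, ideator 3,
`Cruxes/LowEnergyRigidity/Ideas/poincare-telescope.md`, Sketch `Cruxes/LowEnergyRigidity/SketchIdeator3.lean`
§A), over which the companion modules `DeformationLadderLowEnergyRigidityTelescopePoincare` (the
operator Poincaré / refinement inequalities) and `DeformationLadderLowEnergyRigidityTelescopeReduction`
(the dyadic telescope closing the crux by name from the two inputs below) are proved: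

* `cellIndex L k x = ⌊x·k/L⌋ (mod k)` and `cellOf L k x` — the nearly uniform partition of the torus
  `(ℤ/Lℤ)²` into `k × k` CELLS indexed by the cell torus `(ℤ/kℤ)²` (cell sides `⌊L/k⌋` or `⌈L/k⌉`);
  the partitions are NESTED along `k ↦ 2k` (`cellOf L k x = parent (cellOf L (2k) x)`, proved in the
  companion), which is what the telescope uses — `L/ℓ₀` need not be a power of two;
* `cellPair L k b = Σ_{x : cellOf x = b} P_x` — the `d`-wave pair field of the cell `b`
  (`P_x = localPair dWaveFormFactor L x`), so that `Σ_b cellPair L k b = Δ_d` and `cellPair L 1 0 = Δ_d`;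
* `cellCoherence L k = Σ_b (cellPair b)ᴴ cellPair b` — the CELL COHERENCE operator `𝒞_k`
  (`(k²/L⁴)·𝒞_k` is the average cell LRO density at scale `ℓ = L/k`; `𝒞_1 = Δ_dᴴΔ_d`);
* `cellDirichlet L k = Σ_b Σ_{i} (cellPair b − cellPair (b + eᵢ))ᴴ (cellPair b − cellPair (b + eᵢ))` — the
  CELL DIRICHLET operator `𝒟_k` on the cell torus `(ℤ/kℤ)²` (a sum of positive operators; at `k = 2`
  every undirected edge is counted twice, harmlessly);
* `parent k`, `offset k`, `child k` — the combinatorics of the dyadic refinement `(ℤ/2kℤ)² → (ℤ/kℤ)²`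
  (parent cell, position inside the parent, and the inverse bijection), over which the companion
  proves the `2 × 2` refinement inequality `𝒞_k ≥ 4 𝒞_{2k} − 2 𝒟_{2k}` (spectral gap `2` of the
  `4`-cycle, as an exact identity of quadratic forms — no commutativity of the `Δ_b` is used);
* `JosephsonInequalityAt U δ J C ℓ₀` — OPEN INPUT 1 of the card (the `O(1)` content), pointwise in
  `(U, δ)`: on unit vectors of the sector, `J (k/L)⁴ Re⟨𝒟_k⟩ − C J k³/L ≤ Re⟨H_L⟩ − E₀(L)` for all
  cell counts `4 ≤ k` with `k ℓ₀ ≤ L`, eventually in even `L` (as in the Sketch; the telescope consumes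
  the scales `k = 4, 8, 16, …`: the top step `k = 4` by the sharp torus operator Poincaré inequality
  `Δ_dᴴΔ_d ⪰ k² 𝒞_k − (k²/λ₁) 𝒟_k`, `λ₁ = 2 − 2cos(2π/k)`, the lower ones by `2 × 2` refinements);
* `CoherenceFloorAt U δ r₀ ℓ₀` — OPEN INPUT 2 of the card (THERMODYNAMIC content), pointwise in
  `(U, δ)`: unit sector vectors of energy `≤ E₀(L) + c L²` have average cell coherence density
  `(k²/L⁴) Re⟨𝒞_k⟩ ≥ r₀ − ε` at every cell count `k` of the bottom window `k ℓ₀ ≤ L < 2 k ℓ₀` (cell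
  sides in `[ℓ₀, 2ℓ₀]`). DELTA against the Sketch: the Sketch fixes `k = L/ℓ₀`; the dyadic telescope
  lands on the unique power of two in this window instead, so the floor is asked on the window (still
  finitely many cell shapes of bounded size — a thermodynamic statement, by convex duality the sign of
  one one-sided derivative of an energy density under a LOCAL pair-coherence field).

Nothing is proved here. The reduction proved in the companion `…TelescopeReduction` is
`JosephsonInequalityAt U δ J C ℓ₁ → CoherenceFloorAt U δ r₀ ℓ₀ → ℓ₁ ≤ ℓ₀ → C/ℓ₀ < r₀ → LowEnergyRigidity`
(`0 < U`, `δ ∈ (0,1/2)`, `0 < J`, `0 ≤ C`, `0 < ℓ₀`), with the card's budget `a = r₀ − ε − κ/(24J) − C/ℓ₀ − o(1)`;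
the side condition `C/ℓ₀ < r₀` is that budget's positivity made explicit (the Sketch's
`TelescopeReduction` omits it).
Sources: the idea card (ideator 3, 2026-08-16); discrete Poincaré inequality [folklore];
Emery–Kivelson, Nature 374 (1995) 434 and Carlson–Kivelson–Emery–Manousakis, PRL 83 (1999) 612
(granular-superconductor picture); Scalapino, Phys. Rep. 250 (1995) 329 §2 (pair operators).
-/

noncomputable section

namespace Summit.HubbardSuperconductivity.HubbardSuperconductivity.Theorems.LowEnergyRigidity.Telescope

set_option linter.dupNamespace false -- summit = problem name (single-conjunct summit), D-0017

open Matrix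
open scoped ComplexOrder
open Literature.MathematicalPhysics.QuantumLattice Literature.Probability.LatticeModels
open Summit.HubbardSuperconductivity.HubbardSuperconductivity.Theses.DeformationLadder

/-- The one-dimensional cell index at cell count `k`: `x ↦ ⌊x·k/L⌋ (mod k)` on `ℤ/Lℤ` (representative
`x.val ∈ [0, L)`; for `1 ≤ k ≤ L` the value `x.val * k / L` is already `< k`, so the cast is harmless;
cells have `⌊L/k⌋` or `⌈L/k⌉` points). Junk (but well defined) for `k > L` or `L = 0`.
(Idea card poincare-telescope, Sketch `blockIndex`.) [folklore] -/
def cellIndex (L k : ℕ) (x : ZMod L) : ZMod k := ((x.val * k / L : ℕ) : ZMod k)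

/-- The cell of a torus site at cell count `k` (product of the one-dimensional cell indices), an
element of the CELL TORUS `(ℤ/kℤ)²`. (Idea card poincare-telescope, Sketch `blockOf`.) [folklore] -/
def cellOf (L k : ℕ) (x : TorusSite 2 L) : TorusSite 2 k := fun i => cellIndex L k (x i)

/-- The CELL PAIR FIELD `Δ_b = Σ_{x : cellOf x = b} P_x`, `P_x = localPair dWaveFormFactor L x` the
`d`-wave local singlet pair anchored at `x` (bonds leaving the cell are attributed to the anchor's
cell), so that `Σ_b Δ_b = Δ_d = pairField dWaveFormFactor L` exactly.
(Idea card poincare-telescope, Sketch `blockPair`.) [folklore] -/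
def cellPair (L : ℕ) [NeZero L] (k : ℕ) (b : TorusSite 2 k) :
    Matrix (Finset (Orb (FermionTorus 2 L))) (Finset (Orb (FermionTorus 2 L))) ℂ :=
  ∑ x ∈ Finset.univ.filter (fun x : TorusSite 2 L => cellOf L k x = b), localPair dWaveFormFactor L x

/-- The CELL COHERENCE operator `𝒞_k = Σ_b Δ_bᴴ Δ_b` at cell count `k` (positive semidefinite;
`(k²/L⁴)·𝒞_k` is the average cell `d`-wave LRO density at scale `ℓ = L/k`, and `𝒞_1 = Δ_dᴴ Δ_d`).
(Idea card poincare-telescope, Sketch `blockCoherence`.) [folklore] -/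
def cellCoherence (L : ℕ) [NeZero L] (k : ℕ) [NeZero k] :
    Matrix (Finset (Orb (FermionTorus 2 L))) (Finset (Orb (FermionTorus 2 L))) ℂ :=
  ∑ b : TorusSite 2 k, (cellPair L k b)ᴴ * cellPair L k b

/-- The CELL DIRICHLET operator on the cell torus `(ℤ/kℤ)²`:
`𝒟_k = Σ_b Σ_{i = 0,1} (Δ_b − Δ_{b+eᵢ})ᴴ (Δ_b − Δ_{b+eᵢ})` (a sum of positive semidefinite operators over
the directed nearest-neighbour bonds `b → b + eᵢ` of the cell torus; for `k ≥ 3` every undirected bond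
appears once, for `k = 2` twice, for `k = 1` all terms vanish).
(Idea card poincare-telescope, Sketch `blockDirichlet`.) [folklore] -/
def cellDirichlet (L : ℕ) [NeZero L] (k : ℕ) [NeZero k] :
    Matrix (Finset (Orb (FermionTorus 2 L))) (Finset (Orb (FermionTorus 2 L))) ℂ :=
  ∑ b : TorusSite 2 k, ∑ i : Fin 2,
    (cellPair L k b - cellPair L k (b + Pi.single i 1))ᴴ * (cellPair L k b - cellPair L k (b + Pi.single i 1))

/-- DYADIC REFINEMENT `k ↦ 2k`: the parent cell (at count `k`) of a cell `b` of the cell torus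
`(ℤ/2kℤ)²` — halve each coordinate representative, `b ↦ (⌊b₀/2⌋, ⌊b₁/2⌋)`. The cell partitions are
nested along it: `parent k (cellOf L (2k) x) = cellOf L k x` (proved in the companion).
(Idea card poincare-telescope, dyadic chain of scales.) [folklore] -/
def parent (k : ℕ) (b : TorusSite 2 (2 * k)) : TorusSite 2 k := fun i => (((b i).val / 2 : ℕ) : ZMod k)

/-- DYADIC REFINEMENT: the position `s ∈ {0,1}²` of a cell `b` of `(ℤ/2kℤ)²` inside its parent — the
parities of the coordinate representatives. (Idea card poincare-telescope.) [folklore] -/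
def offset (k : ℕ) (b : TorusSite 2 (2 * k)) : Fin 2 → Fin 2 :=
  fun i => ⟨(b i).val % 2, Nat.mod_lt _ two_pos⟩

/-- DYADIC REFINEMENT: the child of the parent cell `B ∈ (ℤ/kℤ)²` at position `s ∈ {0,1}²`, the cell
`(2B₀ + s₀, 2B₁ + s₁) ∈ (ℤ/2kℤ)²`; `(B, s) ↦ child k B s` is a bijection onto `(ℤ/2kℤ)²` with inverse
`b ↦ (parent k b, offset k b)`, and the four children of `B` form a `2 × 2` square of the cell torus
(proved in the companion). (Idea card poincare-telescope.) [folklore] -/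
def child (k : ℕ) (B : TorusSite 2 k) (s : Fin 2 → Fin 2) : TorusSite 2 (2 * k) :=
  fun i => ((2 * (B i).val + (s i).val : ℕ) : ZMod (2 * k))

/-- **Open input 1 — Josephson inequality at every scale** (card `poincare-telescope`, the `O(1)`
content, at the point `(U, δ)` with rate `J` and slack constant `C`, from the lattice scale `ℓ₀` up):
eventually in even `L`, for every cell count `k` with `4 ≤ k` and `k ℓ₀ ≤ L` and every unit vector `φ`
of the sector `szSector (2⌊(1-δ)L²/2⌋) 0`,
`J (k/L)⁴ Re⟨φ, 𝒟_k φ⟩ − C J k³/L ≤ Re⟨φ, H_L φ⟩ − minEnergyOn H_L (sector)`.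
The slack `C J k³/L = C J n_ℓ/ℓ` (`n_ℓ = k²` cells of side `ℓ = L/k`) is extensive at the lattice scale
and `o(1)` at the top scale `k = 4`; `J ≈ ρ_p/2` (pair helicity modulus) would saturate it on twisted
condensates. Route-posited HYPOTHESIS of the telescope (idea card poincare-telescope, Sketch
`JosephsonInequalityAt`, stated for unit vectors); conjecture-grade, never asserted. -/
def JosephsonInequalityAt (U δ J C : ℝ) (ℓ₀ : ℕ) : Prop :=
  ∃ L₀ : ℕ, ∀ (L : ℕ) [NeZero L], L₀ ≤ L → Even L → ∀ (k : ℕ) [NeZero k], 4 ≤ k → k * ℓ₀ ≤ L →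
    ∀ φ : Fock (Orb (FermionTorus 2 L)),
      φ ∈ szSector (Λ := FermionTorus 2 L) (2 * ⌊(1 - δ) * (L : ℝ) ^ 2 / 2⌋₊) 0 →
      star φ ⬝ᵥ φ = 1 →
      J * ((k : ℝ) / (L : ℝ)) ^ 4 * (expect (cellDirichlet L k) φ).re - C * J * (k : ℝ) ^ 3 / (L : ℝ) ≤
        (star φ ⬝ᵥ Matrix.mulVec (hubbardTorus 2 L 1 U) φ).re -
          (hubbardTorus 2 L 1 U).minEnergyOn
            (szSector (Λ := FermionTorus 2 L) (2 * ⌊(1 - δ) * (L : ℝ) ^ 2 / 2⌋₊) 0)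

/-- **Open input 2 — coherence floor at the lattice scale** (card `poincare-telescope`, THERMODYNAMIC
content, at the point `(U, δ)` with floor `r₀` and lattice scale `ℓ₀`): for every `ε > 0` there is an
extensive energy allowance `c > 0` such that, eventually in even `L`, for every cell count `k` in the
bottom window `k ℓ₀ ≤ L < 2 k ℓ₀` (cell sides between `ℓ₀` and `2ℓ₀`) and every unit vector `φ` of the
sector with `Re⟨φ, H_L φ⟩ ≤ minEnergyOn H_L (sector) + c L²`, the average cell coherence density obeys
`r₀ − ε ≤ (k²/L⁴) Re⟨φ, 𝒞_k φ⟩`. By convex duality this is the strict positivity `r₀ = −ε'(0⁻) > 0` of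
one one-sided derivative of the energy density under the LOCAL field `−J'·(k/L)⁴ L² 𝒞_k`.
Route-posited HYPOTHESIS of the telescope (idea card poincare-telescope, input `CoherenceFloorAt`, here
on the dyadic bottom window instead of at `k = L/ℓ₀`); conjecture-grade, never asserted. -/
def CoherenceFloorAt (U δ r₀ : ℝ) (ℓ₀ : ℕ) : Prop :=
  ∀ ε : ℝ, 0 < ε → ∃ c : ℝ, 0 < c ∧ ∃ L₀ : ℕ, ∀ (L : ℕ) [NeZero L], L₀ ≤ L → Even L →
    ∀ (k : ℕ) [NeZero k], k * ℓ₀ ≤ L → L < 2 * k * ℓ₀ →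
    ∀ φ : Fock (Orb (FermionTorus 2 L)),
      φ ∈ szSector (Λ := FermionTorus 2 L) (2 * ⌊(1 - δ) * (L : ℝ) ^ 2 / 2⌋₊) 0 →
      star φ ⬝ᵥ φ = 1 →
      (star φ ⬝ᵥ Matrix.mulVec (hubbardTorus 2 L 1 U) φ).re ≤
        (hubbardTorus 2 L 1 U).minEnergyOn
            (szSector (Λ := FermionTorus 2 L) (2 * ⌊(1 - δ) * (L : ℝ) ^ 2 / 2⌋₊) 0) + c * (L : ℝ) ^ 2 →
      r₀ - ε ≤ ((k : ℝ) ^ 2 / (L : ℝ) ^ 4) * (expect (cellCoherence L k) φ).re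

end Summit.HubbardSuperconductivity.HubbardSuperconductivity.Theorems.LowEnergyRigidity.Telescope
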